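import Summits.CriticalPhenomena.PercolationContinuityZ3.Theorems.PercNearOneGluingNoHeavyQuantGatedSliceMixLawQRouting
import Summits.CriticalPhenomena.PercolationContinuityZ3.Theorems.PercNearOneGluingNoHeavyQuantLawDecUsageMonge
import HarnessLib

/-!
# QUANT lane R8, T-DEC, leg (III), blob case — `LawDec.GatedSliceMixLaw'`, the Q-ALONE side in REGIME R: the first UNCONDITIONAL
# piece-3 class theorem — class `mm` with the twin CLOSED to `k₁` (`2k₁ + a ≤ t`) and the top `k₂ ≤ t` closed or HEAVY for `k₁`:
# `Q = zδ₀ + (1−z)·slice {k₁,k₂;λ} a g` is DEC, by the surplus inequality `A ≤ B + C ⟸ λ ≥ 1 − g(1−z)`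

builds on p205010 (kernel theorem, internal audit signed; external expert review pending)

Support file (`--supports stmt-CriticalPhenomena-4575`), QUANT lane seat prim-quant-arm-1 (gen 41), rung R8 of
`run/shared/lean/prim/quant/LADDER.md`.  Theorems only, standard axioms, no sorries, no definitions.  Uses `…QuantGatedSliceMixLawQRouting`
(this seat: `mixLawQ_decAtT_of_routing`); memo `run/shared/lean/prim/quant/prim-quant-arm-1-g41/Q-ALONE-G41.md` §4(ii)–(iii).

THE CELL (the two biggest piece-3 cells of the census: (mm, P closed, K closed) and (mm, P closed, K heavy) — 51 600 of the 67 300 piece-3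
instances of class mm; `work/explore/qp3.py`).  Frame of the node; `1 ≤ k₁ ≤ j` with `2k₁ + a ≤ t` (so `k₁` is a `t`-low and its twin `P = k₁ + a`
does NOT absorb it), `P ≤ j` a mid (`t ≤ 2P`), the top `K = k₂ ≤ j`, `K ≤ t`, `t ≤ 2K` (a mid not open to the zero), `G = k₂ + a ≥ j+1`, and the pair
`{k₁, K}` closed or heavy: `t < k₁ + K → y·(K − k₁) ≤ t − 2k₁`.  Then `Q` is `DECAtT y t j (M+a)` (`mixLawQ_decAtT_twinClosed`), and the node holds
there with `θ = 0` (`gatedSliceMixLaw'_twinClosed`).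
PROOF.  (1) `λ ≥ 1 − c`, `c = g(1−z)`: from `(1−z)(k₂−k₁)λ = S − (1−z)k₁`, `a(1−c) ≤ S − 2k₁` (twin closed) and `k₂ ≤ t`:
`(1−c)(1−z)(k₂−k₁) ≤ (1−z)[(1−c)(S−k₁) + c(S−2k₁)] ≤ S − (1−z)k₁`.  (2) Hence `A ≤ B + C` (`λ ≥ 1−c ≥ 1−g` and `(1−g)(2−3g) > 1−2g`).  (3) Mean
identity `t·z = −(t−k₁)A − (t−P)B − (t−K)C + (G−t)D` (pure algebra) with `t − P ≥ k₁`, `y·G ≤ t`.  (4) K closed (`k₁ + K ≤ t`): `t − K ≥ k₁`, so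
`t(z + A) ≤ k₁(A − B − C) + t(1−y)/y·D ≤ t(1−y)/y·D`: criterion E, routing `x_G = A`.  K heavy-open: either `k₁` fits into `K` (`usage·A ≤ C`; routing
`x_K = A`, offer = `u·z ≤ D`, which is (3) with every sub-target term dropped) or `K` is saturated (`x_K = C(K+k₁−t)/(t−2k₁)`, `x_G` the rest) and the
offer inequality `u(z + x_G) ≤ D` is `k₁A − (t−P)B − k₁C(2K−t)/(t−2k₁) + (G−t)D ≤ t(1−y)/y·D`, again `⟸ A ≤ B + C` as `2K − t ≥ t − 2k₁`.
HONEST STATUS: remaining class inequalities (mm with the twin open, light tops, mM/Mm/MM/MG, the k₂-low classes) per the memo; `GatedSliceMixLaw'`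
(regime R), CW, `GateMove`, `GatedConvEmptyFree`, `SingleGateConvClosed`, `TreeDEC`, `FarTreeRow` OPEN; RATE class log\* / honest sentence unchanged.

* **`LawDec.mixLawQ_decAtT_twinClosed`**, `LawDec.gatedSliceMixLaw'_twinClosed`.

[this work]; rates / flow form: prim-quant-stmt g22–g26; node: prim-quant-stmt g29 (this lane).  Nothing here is cited as a published result.  The
gluing rows served [cite: KozmaNitzan2024, Conjecture 3 (p. 15)]; product measure [cite: Grimmett1999, §1.3 p. 10].
-/

noncomputable section

namespace Summit.CriticalPhenomena.PercolationContinuityZ3.Theorems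

namespace Quant

open Finset

/-- the two-point law `{lo, hi; g}` (as in `…QuantLawDEC`) -/
local notation3 "TP[" lo ", " hi ", " g ", " h "]" =>
  (g : ℝ) * (if (h : ℕ) = (hi : ℕ) then (1 : ℝ) else 0) + (1 - (g : ℝ)) * (if (h : ℕ) = (lo : ℕ) then (1 : ℝ) else 0)

namespace LawDec

/-! ### Scalar lemmas (small contexts) -/

/-- `a(1−λ) ≤ t − S` (i.e. `λ ≥ 1 − g(1−z)`) in the twin-closed cell: from the mean identity, `2k₁ + a ≤ t` and `k₂ ≤ t`. -/
private theorem lam_ge_aux (z S t lam k₁ k₂ a : ℝ) (h1z : 0 < 1 - z) (hz0 : 0 ≤ z) (hk₁0 : 0 ≤ k₁) (hk : k₁ < k₂) (hlam0 : 0 ≤ lam)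
    (hmean : (1 - z) * (k₁ + (k₂ - k₁) * lam) = S) (hP : 2 * k₁ + a ≤ t) (hKt : k₂ ≤ t) (hd0 : 0 ≤ t - S) (ha0 : 0 ≤ a) :
    a * (1 - lam) ≤ t - S := by
  by_cases had : a ≤ t - S
  · nlinarith [mul_nonneg ha0 hlam0]
  · have had' : t - S < a := not_le.1 had
    have hS0 : 0 ≤ S := by rw [← hmean]; exact mul_nonneg h1z.le (by nlinarith)
    have hW : 0 < k₂ - k₁ := by linarith
    have h1 : (a - (t - S)) * ((1 - z) * (k₂ - k₁)) ≤ (a - (t - S)) * ((1 - z) * (t - k₁)) :=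
      mul_le_mul_of_nonneg_left (mul_le_mul_of_nonneg_left (by linarith) h1z.le) (by linarith)
    have h2 : (a - (t - S)) * ((1 - z) * (t - k₁)) ≤ (1 - z) * (a * (S - k₁)) := by
      have e : (a - (t - S)) * (t - k₁) = a * (S - k₁) - (t - S) * k₁ + (t - S) * ((a - (t - S)) - (S - 2 * k₁)) := by ring
      have h3 : (t - S) * ((a - (t - S)) - (S - 2 * k₁)) ≤ 0 := mul_nonpos_of_nonneg_of_nonpos hd0 (by linarith)
      have h4 : 0 ≤ (t - S) * k₁ := mul_nonneg hd0 hk₁0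
      have : (a - (t - S)) * (t - k₁) ≤ a * (S - k₁) := by rw [e]; linarith
      have := mul_le_mul_of_nonneg_left this h1z.le
      linarith [this]
    have h3 : (1 - z) * (a * (S - k₁)) ≤ a * ((1 - z) * (k₂ - k₁) * lam) := by
      have e : (1 - z) * (k₂ - k₁) * lam = S - (1 - z) * k₁ := by rw [← hmean]; ring
      rw [e]
      nlinarith [mul_nonneg hz0 hS0]
    have key : (a - (t - S)) * ((1 - z) * (k₂ - k₁)) ≤ (a * lam) * ((1 - z) * (k₂ - k₁)) := by
      calc (a - (t - S)) * ((1 - z) * (k₂ - k₁)) ≤ a * ((1 - z) * (k₂ - k₁) * lam) := h1.trans (h2.trans h3)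
        _ = (a * lam) * ((1 - z) * (k₂ - k₁)) := by ring
    have := le_of_mul_le_mul_right key (mul_pos h1z hW)
    linarith

/-- the surplus inequality `A ≤ B + C`: `(1−λ)(1−g) ≤ (1−λ)g + λ(1−g)` for `λ ≥ 1 − g`, `g ≤ 1`, `λ ≤ 1`. -/
private theorem surplus_ABC_aux (g lam : ℝ) (hg1 : g ≤ 1) (hlam1 : lam ≤ 1) (hlam : 1 - g ≤ lam) :
    (1 - lam) * (1 - g) ≤ (1 - lam) * g + lam * (1 - g) := by
  by_cases hg : 1 / 2 ≤ g
  · nlinarith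
  · nlinarith [mul_nonneg (show (0:ℝ) ≤ lam - (1 - g) by linarith) (show (0:ℝ) ≤ 2 - 3 * g by linarith), sq_nonneg (g - 1/2)]

/-- `u·z ≤ D` from the mean identity when every sub-target term is nonnegative (the twin and the top at or below `t`). -/
private theorem ineq_alpha_aux (t y k₁ k₂ a A B C D z : ℝ) (hy0 : 0 < y) (ht0 : 0 < t)
    (htz : t * z = -((t - k₁) * A) - (t - (k₁ + a)) * B - (t - k₂) * C + (k₂ + a - t) * D)
    (hyG : y * (k₂ + a) ≤ t) (hA : 0 ≤ (t - k₁) * A) (hB : 0 ≤ (t - (k₁ + a)) * B) (hC : 0 ≤ (t - k₂) * C) (hD0 : 0 ≤ D) :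
    y * z ≤ (1 - y) * D := by
  have h1 : t * (y * z) ≤ t * ((1 - y) * D) := by
    have e : t * (y * z) = y * (t * z) := by ring
    rw [e, htz]
    nlinarith [mul_le_mul_of_nonneg_right hyG hD0]
  exact le_of_mul_le_mul_left h1 ht0

/-- criterion E in the cell with the top CLOSED (`k₁ + k₂ ≤ t`): `y(z + A) ≤ (1−y)D ⟸ A ≤ B + C`. -/
private theorem ineq_closed_aux (t y k₁ k₂ a A B C D z : ℝ) (hy0 : 0 < y) (ht0 : 0 < t) (hk₁0 : 0 ≤ k₁)
    (htz : t * z = -((t - k₁) * A) - (t - (k₁ + a)) * B - (t - k₂) * C + (k₂ + a - t) * D)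
    (hyG : y * (k₂ + a) ≤ t) (hP : 2 * k₁ + a ≤ t) (hK : k₁ + k₂ ≤ t) (hB0 : 0 ≤ B) (hC0 : 0 ≤ C) (hD0 : 0 ≤ D)
    (hABC : A ≤ B + C) :
    y * (z + A) ≤ (1 - y) * D := by
  have h1 : t * (y * (z + A)) ≤ t * ((1 - y) * D) := by
    have e : t * (y * (z + A)) = y * (t * z) + y * t * A := by ring
    rw [e, htz]
    have hb : k₁ * B ≤ (t - (k₁ + a)) * B := mul_le_mul_of_nonneg_right (by linarith) hB0
    have hc : k₁ * C ≤ (t - k₂) * C := mul_le_mul_of_nonneg_right (by linarith) hC0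
    have hk : k₁ * (A - B - C) ≤ 0 := mul_nonpos_of_nonneg_of_nonpos hk₁0 (by linarith)
    nlinarith [mul_le_mul_of_nonneg_right hyG hD0, mul_le_mul_of_nonneg_left hb hy0.le,
      mul_le_mul_of_nonneg_left hc hy0.le, mul_le_mul_of_nonneg_left hk hy0.le]
  exact le_of_mul_le_mul_left h1 ht0

/-- the offer inequality in the cell with the top OPEN, heavy and SATURATED: `y(z + A − capK) ≤ (1−y)D ⟸ A ≤ B + C`,
`capK·(t−2k₁) = C(k₂+k₁−t)`. -/
private theorem ineq_saturated_aux (t y k₁ k₂ a A B C D z capK : ℝ) (hy0 : 0 < y) (ht0 : 0 < t) (hk₁0 : 0 ≤ k₁)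
    (htz : t * z = -((t - k₁) * A) - (t - (k₁ + a)) * B - (t - k₂) * C + (k₂ + a - t) * D)
    (hyG : y * (k₂ + a) ≤ t) (hP : 2 * k₁ + a ≤ t) (hKc : t < k₁ + k₂) (hW : 2 * k₁ < t) (hB0 : 0 ≤ B) (hC0 : 0 ≤ C) (hD0 : 0 ≤ D)
    (hABC : A ≤ B + C) (hcap : capK * (t - 2 * k₁) = C * (k₂ + k₁ - t)) :
    y * (z + (A - capK)) ≤ (1 - y) * D := by
  have hWp : 0 < t - 2 * k₁ := by linarith
  have e1 : t * (z + (A - capK)) * (t - 2 * k₁)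
      = (k₁ * A - (t - (k₁ + a)) * B + (k₂ + a - t) * D) * (t - 2 * k₁) - k₁ * (2 * k₂ - t) * C := by
    linear_combination (t - 2 * k₁) * htz - t * hcap
  have hb : k₁ * B ≤ (t - (k₁ + a)) * B := mul_le_mul_of_nonneg_right (by linarith) hB0
  have hcC : k₁ * (t - 2 * k₁) * C ≤ k₁ * (2 * k₂ - t) * C :=
    mul_le_mul_of_nonneg_right (mul_le_mul_of_nonneg_left (by linarith) hk₁0) hC0
  have hGD : (k₂ + a - t) * D * y ≤ (t - t * y) * D := by nlinarith [mul_le_mul_of_nonneg_right hyG hD0]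
  have hk : k₁ * (A - B - C) ≤ 0 := mul_nonpos_of_nonneg_of_nonpos hk₁0 (by linarith)
  have h2 : y * (t * (z + (A - capK)) * (t - 2 * k₁)) ≤ (t - t * y) * D * (t - 2 * k₁) := by
    rw [e1]
    nlinarith [mul_le_mul_of_nonneg_right hGD hWp.le, mul_le_mul_of_nonneg_right (mul_le_mul_of_nonneg_left hb hy0.le) hWp.le,
      mul_le_mul_of_nonneg_left hcC hy0.le, mul_le_mul_of_nonneg_right (mul_le_mul_of_nonneg_left hk hy0.le) hWp.le]
  have h3 : (t * (t - 2 * k₁)) * (y * (z + (A - capK))) ≤ (t * (t - 2 * k₁)) * ((1 - y) * D) := by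
    have e2 : (t * (t - 2 * k₁)) * (y * (z + (A - capK))) = y * (t * (z + (A - capK)) * (t - 2 * k₁)) := by ring
    have e3 : (t * (t - 2 * k₁)) * ((1 - y) * D) = (t - t * y) * D * (t - 2 * k₁) := by ring
    rw [e2, e3]; exact h2
  exact le_of_mul_le_mul_left h3 (mul_pos ht0 hWp)

/-! ### The cell theorem -/

/-- **CLASS `mm`, TWIN CLOSED, TOP CLOSED OR HEAVY ⟹ `Q` IS DEC.**  See the file header. [this work] -/
theorem mixLawQ_decAtT_twinClosed (y z g S lam : ℝ) (a j M k₁ k₂ : ℕ)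
    (hy0 : 0 < y) (hy1 : y < 1) (hz0 : 0 ≤ z) (hz1 : z < 1) (hg1 : g ≤ 1) (hyg : y ≤ (1 - z) * g) (ha : 1 ≤ a)
    (hta : y * (M : ℝ) ≤ S) (hk : k₁ ≤ k₂) (hk₂M : k₂ ≤ M) (hlam0 : 0 ≤ lam) (hlam1 : lam ≤ 1)
    (hmean : (1 - z) * ((k₁ : ℝ) + ((k₂ : ℝ) - k₁) * lam) = S)
    (hk₁ : 1 ≤ k₁) (hk₁j : k₁ ≤ j)
    (hPclosed : 2 * (k₁ : ℝ) + a ≤ S + (a : ℝ) * g * (1 - z))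
    (hPj : k₁ + a ≤ j) (hPmid : S + (a : ℝ) * g * (1 - z) ≤ 2 * ((k₁ + a : ℕ) : ℝ))
    (hKj : k₂ ≤ j) (hKmid : S + (a : ℝ) * g * (1 - z) ≤ 2 * (k₂ : ℝ)) (hKt : (k₂ : ℝ) ≤ S + (a : ℝ) * g * (1 - z))
    (hKheavy : S + (a : ℝ) * g * (1 - z) < (k₁ : ℝ) + k₂ → y * ((k₂ : ℝ) - k₁) ≤ S + (a : ℝ) * g * (1 - z) - 2 * (k₁ : ℝ))
    (hG : j + 1 ≤ k₂ + a) :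
    DECAtT y (S + (a : ℝ) * g * (1 - z)) j (M + a)
      (fun p => z * (if p = 0 then (1 : ℝ) else 0) + (1 - z) * slice (fun q => TP[k₁, k₂, lam, q]) a g p) := by
  set t : ℝ := S + (a : ℝ) * g * (1 - z) with ht
  set A : ℝ := (1 - z) * (1 - lam) * (1 - g) with hA
  set B : ℝ := (1 - z) * (1 - lam) * g with hB
  set C : ℝ := (1 - z) * lam * (1 - g) with hC
  set D : ℝ := (1 - z) * lam * g with hD
  have hg0 : 0 < g := by
    by_contra hc
    have : (1 - z) * g ≤ 0 := mul_nonpos_of_nonneg_of_nonpos (by linarith) (not_lt.1 hc)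
    linarith
  have h1z : 0 < 1 - z := by linarith
  have h1y : 0 < 1 - y := by linarith
  have hA0 : 0 ≤ A := mul_nonneg (mul_nonneg h1z.le (by linarith)) (by linarith)
  have hB0 : 0 ≤ B := mul_nonneg (mul_nonneg h1z.le (by linarith)) hg0.le
  have hC0 : 0 ≤ C := mul_nonneg (mul_nonneg h1z.le hlam0) (by linarith)
  have hD0 : 0 ≤ D := mul_nonneg (mul_nonneg h1z.le hlam0) hg0.le
  have ha0 : (1 : ℝ) ≤ a := by exact_mod_cast ha
  have hk₁r : (1 : ℝ) ≤ k₁ := by exact_mod_cast hk₁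
  have hkr : (k₁ : ℝ) ≤ k₂ := by exact_mod_cast hk
  have hk₁low : 2 * (k₁ : ℝ) < t := by rw [ht]; linarith
  have ht0 : 0 < t := by linarith
  have hPr : ((k₁ + a : ℕ) : ℝ) = (k₁ : ℝ) + a := by push_cast; ring
  have hk₁k₂ : (k₁ : ℝ) < k₂ := by linarith
  -- mass and mean (pure algebra)
  have hmass : z + A + B + C + D = 1 := by rw [hA, hB, hC, hD]; ring
  have hmom : (k₁ : ℝ) * A + ((k₁ : ℝ) + a) * B + (k₂ : ℝ) * C + ((k₂ : ℝ) + a) * D = t := by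
    rw [hA, hB, hC, hD, ht, ← hmean]; ring
  have htz : t * z = -((t - k₁) * A) - (t - ((k₁ : ℝ) + a)) * B - (t - k₂) * C + ((k₂ : ℝ) + a - t) * D := by
    have e1 : t * z = t * (1 - A - B - C - D) := by rw [← hmass]; ring
    rw [e1]; linarith [hmom]
  -- top-affordability of the shifted top
  have hyG : y * ((k₂ : ℝ) + a) ≤ t := by
    have h1 : y * (k₂ : ℝ) ≤ y * M := mul_le_mul_of_nonneg_left (by exact_mod_cast hk₂M) hy0.le
    have h3 : y * (a : ℝ) ≤ (a : ℝ) * g * (1 - z) := by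
      calc y * (a : ℝ) ≤ (1 - z) * g * (a : ℝ) := mul_le_mul_of_nonneg_right hyg (Nat.cast_nonneg a)
        _ = (a : ℝ) * g * (1 - z) := by ring
    have e : y * ((k₂ : ℝ) + a) = y * (k₂ : ℝ) + y * (a : ℝ) := by ring
    rw [e, ht]; linarith
  -- (1)–(2): `λ ≥ 1 − g(1−z) ≥ 1 − g`, hence `A ≤ B + C`
  have hlam : 1 - g ≤ lam := by
    have hd : t - S = (a : ℝ) * g * (1 - z) := by rw [ht]; ring
    have h := lam_ge_aux z S t lam k₁ k₂ a h1z hz0 (by linarith) hk₁k₂ hlam0 hmean hPclosed hKt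
      (by rw [hd]; exact mul_nonneg (mul_nonneg (by linarith) hg0.le) h1z.le) (by linarith)
    rw [hd] at h
    -- `a(1−λ) ≤ a g (1−z) ≤ a g`
    have h2 : (a : ℝ) * g * (1 - z) ≤ (a : ℝ) * g := by
      have : 0 ≤ (a : ℝ) * g * z := mul_nonneg (mul_nonneg (by linarith) hg0.le) hz0
      linarith
    have h3 : (a : ℝ) * (1 - lam) ≤ (a : ℝ) * g := h.trans h2
    have := le_of_mul_le_mul_left h3 (by linarith : (0 : ℝ) < a)
    linarith
  have hABC : A ≤ B + C := by
    have h := mul_le_mul_of_nonneg_left (surplus_ABC_aux g lam hg1 hlam1 hlam) h1z.le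
    have e1 : (1 - z) * ((1 - lam) * (1 - g)) = A := by rw [hA]; ring
    have e2 : (1 - z) * ((1 - lam) * g + lam * (1 - g)) = B + C := by rw [hB, hC]; ring
    linarith [e1, e2]
  -- the usage rate at the giant `G`
  have huG : usage y t j k₁ (k₂ + a) = y / (1 - y) := usage_giant_eq y t j k₁ (k₂ + a) hG
  -- the offer target in the routing theorem reduces to the `G`-term
  have hoffer_of : ∀ (xK xG : ℝ), y * (z + xG) ≤ (1 - y) * D →
      t * z ≤
        (if j + 1 ≤ k₁ + a then t * (1 - y) / y else if t < ((k₁ + a : ℕ) : ℝ) then ((k₁ + a : ℕ) : ℝ) - t else 0)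
            * (B - usage y t j k₁ (k₁ + a) * 0)
          + (if j + 1 ≤ k₂ then t * (1 - y) / y else if t < (k₂ : ℝ) then (k₂ : ℝ) - t else 0)
            * (C - usage y t j k₁ k₂ * xK)
          + t * (1 - y) / y * (D - usage y t j k₁ (k₂ + a) * xG) := by
    intro xK xG hE
    rw [if_neg (by omega : ¬ (j + 1 ≤ k₁ + a)), hPr, if_neg (by linarith : ¬ (t < (k₁ : ℝ) + a)),
      if_neg (by omega : ¬ (j + 1 ≤ k₂)), if_neg (not_lt.2 hKt), huG, zero_mul, zero_mul, zero_add, zero_add]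
    have hz : z ≤ (1 - y) / y * D - xG := by
      rw [div_mul_eq_mul_div, le_sub_iff_add_le, le_div_iff₀ hy0]
      linarith [hE, mul_comm y (z + xG)]
    have e : t * (1 - y) / y * (D - y / (1 - y) * xG) = t * ((1 - y) / y * D - xG) := by
      have hy0' : y ≠ 0 := ne_of_gt hy0
      have h1y' : 1 - y ≠ 0 := ne_of_gt h1y
      field_simp
    rw [e]
    exact mul_le_mul_of_nonneg_left hz ht0.le
  have hcapG_of : ∀ xG : ℝ, 0 ≤ z → y * (z + xG) ≤ (1 - y) * D → usage y t j k₁ (k₂ + a) * xG ≤ D := by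
    intro xG _ hE
    rw [huG, div_mul_eq_mul_div, div_le_iff₀ h1y]
    have : y * xG ≤ y * (z + xG) := by nlinarith
    linarith [mul_comm (1 - y) D]
  by_cases hKc : t < (k₁ : ℝ) + k₂
  · -- the top is OPEN to `k₁` and heavy
    have hρy : y * ((k₂ : ℝ) - k₁) ≤ t - 2 * (k₁ : ℝ) := hKheavy hKc
    set ρ : ℝ := (t - 2 * (k₁ : ℝ)) / ((k₂ : ℝ) - k₁) with hρ
    have hd : (0 : ℝ) < (k₂ : ℝ) - k₁ := by linarith
    have hρ0 : 0 < ρ := div_pos (by linarith) hd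
    have hρ1 : ρ < 1 := by rw [hρ, div_lt_one hd]; linarith
    have hyρ : y ≤ ρ := by rw [hρ, le_div_iff₀ hd]; linarith
    have huK : usage y t j k₁ k₂ = ρ / (1 - ρ) := by
      have hng : ¬ (j + 1 ≤ k₂) := by omega
      have hmax : y ^ 2 + (1 - y) * ρ ≤ ρ := by
        have h := mul_nonpos_of_nonneg_of_nonpos hy0.le (sub_nonpos.2 hyρ)
        have e : y ^ 2 + (1 - y) * ρ = ρ + y * (y - ρ) := by ring
        rw [e]; linarith
      simp only [usage, gateOf, if_neg hng, pairGate]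
      rw [← hρ, max_eq_left hmax]
    set capK : ℝ := C * (1 - ρ) / ρ with hcapK
    have hcapK0 : 0 ≤ capK := div_nonneg (mul_nonneg hC0 (by linarith)) hρ0.le
    have hcapK_eq : capK * (t - 2 * (k₁ : ℝ)) = C * ((k₂ : ℝ) + k₁ - t) := by
      have hW : (k₂ : ℝ) - k₁ ≠ 0 := ne_of_gt hd
      have hW2 : t - 2 * (k₁ : ℝ) ≠ 0 := by linarith
      rw [hcapK, hρ]
      field_simp
      ring
    have hρne : 1 - ρ ≠ 0 := ne_of_gt (by linarith)
    have hρne0 : ρ ≠ 0 := ne_of_gt hρ0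
    have hsat : usage y t j k₁ k₂ * capK = C := by
      rw [huK, hcapK, div_mul_div_comm, mul_comm (1 - ρ) ρ, ← mul_assoc]
      rw [mul_div_mul_right _ _ hρne, mul_comm ρ C, mul_div_assoc, div_self hρne0, mul_one]
    by_cases hfit : A ≤ capK
    · -- `k₁` fits into the top: `x_K = A`; the offer inequality is `u z ≤ D`
      have huse : usage y t j k₁ k₂ * A ≤ C := by
        have : usage y t j k₁ k₂ * A ≤ usage y t j k₁ k₂ * capK :=
          mul_le_mul_of_nonneg_left hfit (by rw [huK]; exact div_nonneg hρ0.le (by linarith))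
        linarith [hsat]
      have hE : y * (z + 0) ≤ (1 - y) * D := by
        rw [add_zero]
        exact ineq_alpha_aux t y k₁ k₂ a A B C D z hy0 ht0 htz hyG (mul_nonneg (by linarith) hA0)
          (mul_nonneg (by linarith) hB0) (mul_nonneg (by linarith) hC0) hD0
      refine mixLawQ_decAtT_of_routing y z g S lam a j M k₁ k₂ 0 A 0 hy0 hy1 hz0 hz1 hg1 hyg ha hta hk hk₂M hlam0 hlam1 hmean
        hk₁ hk₁j hk₁low (Or.inl hPmid) (Or.inl hKmid) hG le_rfl hA0 le_rfl (by ring)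
        (fun h => absurd h (lt_irrefl _)) (fun _ => Or.inr hKc) (by rw [mul_zero]; exact hB0) huse
        (hcapG_of 0 hz0 hE) (hoffer_of A 0 hE)
    · -- the top is saturated; the rest of `k₁` and the zero ride the giant
      have hfit' : capK < A := not_le.1 hfit
      have hE : y * (z + (A - capK)) ≤ (1 - y) * D :=
        ineq_saturated_aux t y k₁ k₂ a A B C D z capK hy0 ht0 (by linarith) htz hyG hPclosed hKc hk₁low hB0 hC0 hD0 hABC hcapK_eq
      refine mixLawQ_decAtT_of_routing y z g S lam a j M k₁ k₂ 0 capK (A - capK) hy0 hy1 hz0 hz1 hg1 hyg ha hta hk hk₂M hlam0 hlam1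
        hmean hk₁ hk₁j hk₁low (Or.inl hPmid) (Or.inl hKmid) hG le_rfl hcapK0 (by linarith) (by ring)
        (fun h => absurd h (lt_irrefl _)) (fun _ => Or.inr hKc) (by rw [mul_zero]; exact hB0) (le_of_eq hsat)
        (hcapG_of (A - capK) hz0 hE) (hoffer_of capK (A - capK) hE)
  · -- the top is CLOSED to `k₁`: criterion E, `x_G = A`
    have hKc' : (k₁ : ℝ) + k₂ ≤ t := not_lt.1 hKc
    have hE : y * (z + A) ≤ (1 - y) * D :=
      ineq_closed_aux t y k₁ k₂ a A B C D z hy0 ht0 (by linarith) htz hyG hPclosed hKc' hB0 hC0 hD0 hABC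
    refine mixLawQ_decAtT_of_routing y z g S lam a j M k₁ k₂ 0 0 A hy0 hy1 hz0 hz1 hg1 hyg ha hta hk hk₂M hlam0 hlam1 hmean
      hk₁ hk₁j hk₁low (Or.inl hPmid) (Or.inl hKmid) hG le_rfl le_rfl hA0 (by ring)
      (fun h => absurd h (lt_irrefl _)) (fun h => absurd h (lt_irrefl _)) (by rw [mul_zero]; exact hB0) (by rw [mul_zero]; exact hC0)
      (hcapG_of A hz0 hE) (hoffer_of 0 A hE)

/-- **`GatedSliceMixLaw'` with θ = 0 in the twin-closed cell of class `mm`.** [this work] -/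
theorem gatedSliceMixLaw'_twinClosed (y z g S lam : ℝ) (a j M h k₁ k₂ : ℕ)
    (hy0 : 0 < y) (hy1 : y < 1) (hz0 : 0 ≤ z) (hz1 : z < 1) (hg1 : g ≤ 1) (hyg : y ≤ (1 - z) * g) (ha : 1 ≤ a)
    (hta : y * (M : ℝ) ≤ S) (hk : k₁ ≤ k₂) (hk₂M : k₂ ≤ M) (hlam0 : 0 ≤ lam) (hlam1 : lam ≤ 1)
    (hmean : (1 - z) * ((k₁ : ℝ) + ((k₂ : ℝ) - k₁) * lam) = S)
    (hk₁ : 1 ≤ k₁) (hk₁j : k₁ ≤ j)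
    (hPclosed : 2 * (k₁ : ℝ) + a ≤ S + (a : ℝ) * g * (1 - z))
    (hPj : k₁ + a ≤ j) (hPmid : S + (a : ℝ) * g * (1 - z) ≤ 2 * ((k₁ + a : ℕ) : ℝ))
    (hKj : k₂ ≤ j) (hKmid : S + (a : ℝ) * g * (1 - z) ≤ 2 * (k₂ : ℝ)) (hKt : (k₂ : ℝ) ≤ S + (a : ℝ) * g * (1 - z))
    (hKheavy : S + (a : ℝ) * g * (1 - z) < (k₁ : ℝ) + k₂ → y * ((k₂ : ℝ) - k₁) ≤ S + (a : ℝ) * g * (1 - z) - 2 * (k₁ : ℝ))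
    (hG : j + 1 ≤ k₂ + a) :
    ∃ θ : ℝ, 0 ≤ θ ∧ θ < 1 ∧
      DECAtT y (S + (a : ℝ) * g * (1 - z)) j (M + a)
        (fun p => θ * weakMidLaw S g h a p
          + (1 - θ) * (z * (if p = 0 then (1 : ℝ) else 0) + (1 - z) * slice (fun q => TP[k₁, k₂, lam, q]) a g p)) := by
  refine ⟨0, le_rfl, zero_lt_one, ?_⟩
  refine decAtT_congr (fun p => ?_)
    (mixLawQ_decAtT_twinClosed y z g S lam a j M k₁ k₂ hy0 hy1 hz0 hz1 hg1 hyg ha hta hk hk₂M hlam0 hlam1 hmean hk₁ hk₁j hPclosed hPj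
      hPmid hKj hKmid hKt hKheavy hG)
  ring

end LawDec

end Quant

end Summit.CriticalPhenomena.PercolationContinuityZ3.Theorems
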